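/-
Copyright (c) 2026 the pub-hodgecm-mathlib formalisation cell (harness21).  Prover seat hodgecm-mathlib-F0P3a-p08 (g21): road «S3-ram» (LEAD F0P3a-plan (g13);
owner ∕ (α) keeper F0P3a-p06 (g16); (Cnt2′) chair F0P3a-p07 (g15) RULING (13)(6): `stub_Zhyp` composition pen), organ «(K5-B-J) KIND COUNTS OF THE HYPERBOLIC ROOT
REGION IN JUNCTION CURRENCY», FILE 2: generic label transport along `B ↦ u·B` + the INNER kind count in closed form (CM dress); 2026-09-02.
-/
import Literature.NumberTheory.Automorphic.UnitaryLatticeTreeBlockRootRegionAxisKinds                                -- ★ p849463 (this seat): FILE 1, the kind-keyed region read on the `W`-block of `B₀`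
import Literature.NumberTheory.Rogawski1990.TypeTwoRamifiedHyperbolicRootRegionCount                                   -- ★ p849388 (A-p19 (g29)): brings ★ FILE 4 (`ncard_selfDual_fixed_centredBall_inv_conj_scalar_mul_eq`, `trace_coe_inv_conj_scalar_mul`, `v_det_rerootedCentred_sub_one_eq_ram`), ★ FILES 1–3, ★ A-p12 WSideBalls, ★ chair DepthDictionary
import Literature.NumberTheory.Rogawski1990.DepthZeroKappaTransferTypeTwoRamifiedWSideLatticeCurrencyCentredShellCount   -- ★ p849204 (F0P3a-p05 (g18)) (K5-b) IX: centred-shell class halves `…class_eq_of_even∕…class_eq_pow_of_odd`, `setOf_…_not_class_eq_class_mul_…`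
import Literature.NumberTheory.Rogawski1990.DepthZeroKappaTransferTypeTwoRamifiedWSideLatticeCurrencyTop                 -- ★ p849304 (F0P3a-p05 (g18)) X: the top shell ∕ top ball at even `N`
import Literature.NumberTheory.Automorphic.UnitaryLatticeTreeCountsClassFunction                                     -- ★ `ncard_selfDual_fixed_sep_conj_eq_of_mem_unitaryGroupOfForm` (labelled count at a unitary conjugate)
import Literature.NumberTheory.Automorphic.UnitaryLatticeTreeFormTransport                                          -- ★ `map_toLin'_conj_mapGL_le_scaleLattice_iff`, `exists_mem_mapGL_pairing_conj_iff`
import HarnessLib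

/-!
# The KIND COUNTS of the regime-B hyperbolic root region in junction currency, I: label transport along `B ↦ u·B`, and the INNER count in closed form
# (Kottwitz 1986 §3; Rogawski 1990 §4.9; Labesse–Langlands 1979 §2; Bruhat–Tits 1972 §10)

Topic `NumberTheory/Rogawski1990`; namespaces `Literature.NumberTheory.Automorphic.UnitaryLatticeTree` (§1, generic `K`) and `Literature.NumberTheory.Rogawski1990.BlockLawHyp`
(§2–§3, CM dress).  THEOREMS ONLY (no definition, no instance, no notation, no named fact, no `sorry`); kernel lane `--supports stmt-HodgeConjecture-24833`.  Cell
`pub/hodgecm-mathlib` (D-0151), crux H413; road «S3-ram» (count-neutral); the (α) BLOCK-LAW skeleton (keeper F0P3a-p06 (g16) v2.3, chair F0P3a-p07 (g15) RULINGS (13)–(17)),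
regime-B hyperbolic cells `stub_Zhyp_{zero,pm}_{even,odd}_B` (this seat, composition pen).  Their pooled census ((4a) ★ `regionCensus_block_of_kindCounts`, F0P3-p03 (g16))
takes the per-kind VALUES ((K4b), A-p12 (g25)) and the KIND MULTIPLICITIES `n₀ n₁ n₂` of the root region `R(γ, m)` of the re-rooted centred literal `γ = ι(B₀, 1)`,
`B₀ = k⁻¹·(s·ĝ_w)·k` (★ A-p19 (g29) (h1) FILES 1–4), split by A-p12's frozen kind tokens `Pin` (INNER: the centred `W`-block is deeper than `m` on the vertex) and `Qbig`
(the centred rank-one class of the vertex against the lock datum `t₀ = (ϖ^m)⁻¹(½tr B₀ − 1)`).  THIS FILE gives the three multiplicities in CLOSED FORM at a tame-ramified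
place, regime B (`m = 2k′ + 3 < N`, `n = a + k′ + 1`, `q = #(𝓞_{L⁺}∕v)`):
* **`ncard_rootRegion_inner_hyperbolic_of_even_B_ram`** — `n_inner = (q+1)·Σ_{i<a−1} q^i` (`N = 2n`); **`…_of_odd_B_ram`** — `n_inner + 1 = 2·Σ_{i<a} q^i` (`N = 2n+1`);
* (FILE 3 `…HyperbolicRegionShellKindsOdd`) `ncard_rootRegion_shell{Big,Small}_hyperbolic_of_odd_B_ram` — `n_big = n_small = q^a`;
* (FILE 4 `…HyperbolicRegionShellKindsEven`) `two_mul_ncard_rootRegion_shell{Big,Small}_hyperbolic_of_even_B_ram` — `2·n_big = 2·n_small = (q+1)·q^(a−1)`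
(so `n_shell = (q−1)·n_inner + q + 1` = the outermost layer of the `W`-ball, ref5 (g7) R-458).  THIS FILE: §1 the generic transport lemmas, §2 the INNER count.  ROUTE: FILE 1 reads each kind on the `W`-block of `B₀` (§2 of ★ p849463);
§1 here moves a centred-token label along `B ↦ k·B` from `B₀ = k⁻¹(s·ĝ_w)k` to `s·ĝ_w` (★ `ncard_selfDual_fixed_sep_conj_eq_of_mem_unitaryGroupOfForm`, the class token by
★ `exists_mem_mapGL_pairing_conj_iff` — `k` is an isometry, so the constant `t₀` is unchanged); on the `W`-side the plain level-`m` token is the centred one (★ A-p12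
`selfDual_fixed_lev_eq_ball_of_le`, `|½tr B₀ − 1| = |ϖ|^m` = chair dictionary clause (B)), odd centred scales collapse (★ A-p12 `selfDual_fixed_ball_odd_scale_eq`), the unit
scalar `s` is dropped for the ball (★ A-p19 `ncard_selfDual_fixed_centredBall_inv_conj_scalar_mul_eq`) and kept for the shell, where p05 (g18)'s ★ centred-shell halves are read
at the pulled-back element `γ₂′ := (localNonsplitEquiv …).symm ⟨s·ĝ_w, _⟩` (its `hcD : |½tr(s·ĝ_w) − 1| ≤ |ϖ|^m` holds because `s·û_w = 1`).
HONEST LABEL: HC_CM is proved only modulo the 2 remaining named inputs (hLiu418 24832, h413 24833) until rung 0 closes; nothing printed is asserted here (lattice bookkeeping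
over ★ results); «S3-ram» has no books consequence.

## References
* [Kottwitz1986] R. E. Kottwitz, *Base change for unit elements of Hecke algebras*, Compositio Math. 60 (1986), §3 (counting fixed lattices shell by shell).
* [Rogawski1990] J. D. Rogawski, *Automorphic Representations of Unitary Groups in Three Variables*, Ann. of Math. Stud. 123 (1990), §4.9 pp. 54–56, Lemma 4.9.3.
* [LabesseLanglands1979] J.-P. Labesse, R. P. Langlands, *L-indistinguishability for SL(2)*, Canad. J. Math. 31 (1979), §2 Lemma 2.1 p. 8.
* [BruhatTits1972] F. Bruhat, J. Tits, *Groupes réductifs sur un corps local I*, Publ. Math. IHÉS 41 (1972), §10.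
-/

set_option autoImplicit false

noncomputable section

open scoped Valued WithZero Matrix MatrixGroups
open Polynomial NumberField IsDedekindDomain
open Literature.NumberTheory.Automorphic Literature.NumberTheory.Automorphic.HermitianLattice Literature.NumberTheory.Automorphic.UnitaryLatticeTree
open Literature.NumberTheory.Automorphic.UnitaryGroup Literature.NumberTheory.GaloisRepresentations
open Literature.NumberTheory.Rogawski1990

/-! ## §1 Moving a centred-token label along `B ↦ u·B` (generic `K`) -/

namespace Literature.NumberTheory.Automorphic.UnitaryLatticeTree

section Generic

variable {K : Type*} [Field K] [Valued K ℤᵐ⁰]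

omit [Valued K ℤᵐ⁰] in
/-- `uGu⁻¹ − ½tr(uGu⁻¹)·1 = u·(G − ½tr G·1)·u⁻¹`. [cite: Kottwitz1986, §3] -/
theorem coe_conj_sub_half_trace_smul_one_eq (u G : GL (Fin 2) K) :
    ((u * G * u⁻¹ : GL (Fin 2) K) : Matrix (Fin 2) (Fin 2) K) - (((u * G * u⁻¹ : GL (Fin 2) K) : Matrix (Fin 2) (Fin 2) K).trace / 2) • (1 : Matrix (Fin 2) (Fin 2) K) =
      (u : Matrix (Fin 2) (Fin 2) K) * ((G : Matrix (Fin 2) (Fin 2) K) - ((G : Matrix (Fin 2) (Fin 2) K).trace / 2) • (1 : Matrix (Fin 2) (Fin 2) K)) *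
        ((u⁻¹ : GL (Fin 2) K) : Matrix (Fin 2) (Fin 2) K) := by
  rw [Units.val_mul, Units.val_mul, Matrix.trace_units_conj]
  have huu : (u : Matrix (Fin 2) (Fin 2) K) * ((u⁻¹ : GL (Fin 2) K) : Matrix (Fin 2) (Fin 2) K) = 1 := by
    rw [← Units.val_mul, mul_inv_cancel, Units.val_one]
  rw [Matrix.mul_sub, Matrix.sub_mul, Matrix.mul_smul, Matrix.smul_mul, Matrix.mul_one, huu]

/-- **LABELLED COUNT AT A UNITARY CONJUGATE — INNER LABEL** (plain level `c` and centred level `c'`): for `u ∈ U(σ, H)`,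
`#{M ∣ SD_H M ∧ (uGu⁻¹)M = M ∧ ((uGu⁻¹ − 1)M ⊆ cM ∧ (uGu⁻¹ − ½tr·1)M ⊆ c'M)} = #{M ∣ SD_H M ∧ GM = M ∧ ((G − 1)M ⊆ cM ∧ (G − ½tr G·1)M ⊆ c'M)}` (`M ↦ u·M`).
[cite: Kottwitz1986, §3] [cite: LabesseLanglands1979, §2 Lemma 2.1 p. 8] -/
theorem ncard_selfDual_fixed_lev_centredLev_conj_eq (σ : K →+* K) (ϖ : K) (H : Matrix (Fin 2) (Fin 2) K) {u : GL (Fin 2) K} (hu : u ∈ unitaryGroupOfForm σ H)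
    (G : GL (Fin 2) K) (c c' : K) :
    {M : Submodule 𝒪[K] (Fin 2 → K) | IsSelfDualLattice σ ϖ H M ∧ mapGL (u * G * u⁻¹) M = M ∧
        (M.map ((Matrix.toLin' (((u * G * u⁻¹ : GL (Fin 2) K) : Matrix (Fin 2) (Fin 2) K) - 1)).restrictScalars 𝒪[K]) ≤ scaleLattice c M ∧
          M.map ((Matrix.toLin' (((u * G * u⁻¹ : GL (Fin 2) K) : Matrix (Fin 2) (Fin 2) K) -
            (((u * G * u⁻¹ : GL (Fin 2) K) : Matrix (Fin 2) (Fin 2) K).trace / 2) • (1 : Matrix (Fin 2) (Fin 2) K))).restrictScalars 𝒪[K]) ≤ scaleLattice c' M)}.ncard =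
      {M : Submodule 𝒪[K] (Fin 2 → K) | IsSelfDualLattice σ ϖ H M ∧ mapGL G M = M ∧
        (M.map ((Matrix.toLin' ((G : Matrix (Fin 2) (Fin 2) K) - 1)).restrictScalars 𝒪[K]) ≤ scaleLattice c M ∧
          M.map ((Matrix.toLin' ((G : Matrix (Fin 2) (Fin 2) K) - ((G : Matrix (Fin 2) (Fin 2) K).trace / 2) • (1 : Matrix (Fin 2) (Fin 2) K))).restrictScalars 𝒪[K]) ≤
            scaleLattice c' M)}.ncard := by
  refine ncard_selfDual_fixed_sep_conj_eq_of_mem_unitaryGroupOfForm σ ϖ H hu G _ _ fun M => ?_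
  rw [map_conj_sub_one_le_scaleLattice_iff, coe_conj_sub_half_trace_smul_one_eq, map_toLin'_conj_mapGL_le_scaleLattice_iff]

/-- **LABELLED COUNT AT A UNITARY CONJUGATE — SHELL LABEL WITH THE CENTRED CLASS PRESENT** (centred levels `c`, `c'`, class scale `r`, constant `t`): for `u ∈ U(σ, H)` the
count of `{SD_H, (uGu⁻¹)-fixed, (uGu⁻¹ − ½tr·1)M ⊆ cM, ¬ ⊆ c'M, ∃ y ∈ M, a ∈ 𝒪^×: |r⟨y, (uGu⁻¹ − ½tr·1)y⟩_H − t·a²| < 1}` equals the same count for `G` — `u` is an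
isometry of `H`, so the class constant is unchanged (★ `exists_mem_mapGL_pairing_conj_iff`). [cite: Kottwitz1986, §3] [cite: LabesseLanglands1979, §2 Lemma 2.1 p. 8] -/
theorem ncard_selfDual_fixed_centredShell_class_conj_eq (σ : K →+* K) (ϖ : K) (H : Matrix (Fin 2) (Fin 2) K) {u : GL (Fin 2) K} (hu : u ∈ unitaryGroupOfForm σ H)
    (G : GL (Fin 2) K) (c c' r t : K) :
    {M : Submodule 𝒪[K] (Fin 2 → K) | IsSelfDualLattice σ ϖ H M ∧ mapGL (u * G * u⁻¹) M = M ∧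
        (M.map ((Matrix.toLin' (((u * G * u⁻¹ : GL (Fin 2) K) : Matrix (Fin 2) (Fin 2) K) -
            (((u * G * u⁻¹ : GL (Fin 2) K) : Matrix (Fin 2) (Fin 2) K).trace / 2) • (1 : Matrix (Fin 2) (Fin 2) K))).restrictScalars 𝒪[K]) ≤ scaleLattice c M ∧
          ¬ M.map ((Matrix.toLin' (((u * G * u⁻¹ : GL (Fin 2) K) : Matrix (Fin 2) (Fin 2) K) -
            (((u * G * u⁻¹ : GL (Fin 2) K) : Matrix (Fin 2) (Fin 2) K).trace / 2) • (1 : Matrix (Fin 2) (Fin 2) K))).restrictScalars 𝒪[K]) ≤ scaleLattice c' M ∧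
          ∃ y ∈ M, ∃ a : K, Valued.v a = 1 ∧ Valued.v (r * pairing σ H y ((((u * G * u⁻¹ : GL (Fin 2) K) : Matrix (Fin 2) (Fin 2) K) -
            (((u * G * u⁻¹ : GL (Fin 2) K) : Matrix (Fin 2) (Fin 2) K).trace / 2) • (1 : Matrix (Fin 2) (Fin 2) K)) *ᵥ y) - t * a ^ 2) < 1)}.ncard =
      {M : Submodule 𝒪[K] (Fin 2 → K) | IsSelfDualLattice σ ϖ H M ∧ mapGL G M = M ∧
        (M.map ((Matrix.toLin' ((G : Matrix (Fin 2) (Fin 2) K) - ((G : Matrix (Fin 2) (Fin 2) K).trace / 2) • (1 : Matrix (Fin 2) (Fin 2) K))).restrictScalars 𝒪[K]) ≤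
            scaleLattice c M ∧
          ¬ M.map ((Matrix.toLin' ((G : Matrix (Fin 2) (Fin 2) K) - ((G : Matrix (Fin 2) (Fin 2) K).trace / 2) • (1 : Matrix (Fin 2) (Fin 2) K))).restrictScalars 𝒪[K]) ≤
            scaleLattice c' M ∧
          ∃ y ∈ M, ∃ a : K, Valued.v a = 1 ∧ Valued.v (r * pairing σ H y (((G : Matrix (Fin 2) (Fin 2) K) - ((G : Matrix (Fin 2) (Fin 2) K).trace / 2) •
            (1 : Matrix (Fin 2) (Fin 2) K)) *ᵥ y) - t * a ^ 2) < 1)}.ncard := by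
  refine ncard_selfDual_fixed_sep_conj_eq_of_mem_unitaryGroupOfForm σ ϖ H hu G _ _ fun M => ?_
  rw [coe_conj_sub_half_trace_smul_one_eq, map_toLin'_conj_mapGL_le_scaleLattice_iff, map_toLin'_conj_mapGL_le_scaleLattice_iff]
  refine and_congr Iff.rfl (and_congr Iff.rfl ?_)
  have h := exists_mem_mapGL_pairing_conj_iff σ H u ((G : Matrix (Fin 2) (Fin 2) K) - ((G : Matrix (Fin 2) (Fin 2) K).trace / 2) • (1 : Matrix (Fin 2) (Fin 2) K)) M
    (fun x => ∃ a : K, Valued.v a = 1 ∧ Valued.v (r * x - t * a ^ 2) < 1)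
  rw [formCongr_eq_of_mem_unitaryGroupOfForm σ H hu] at h
  exact h

/-- **LABELLED COUNT AT A UNITARY CONJUGATE — SHELL LABEL WITH THE CENTRED CLASS ABSENT** (the twin with `¬∃`). [cite: Kottwitz1986, §3] [cite: LabesseLanglands1979, §2 Lemma 2.1 p. 8] -/
theorem ncard_selfDual_fixed_centredShell_not_class_conj_eq (σ : K →+* K) (ϖ : K) (H : Matrix (Fin 2) (Fin 2) K) {u : GL (Fin 2) K} (hu : u ∈ unitaryGroupOfForm σ H)
    (G : GL (Fin 2) K) (c c' r t : K) :
    {M : Submodule 𝒪[K] (Fin 2 → K) | IsSelfDualLattice σ ϖ H M ∧ mapGL (u * G * u⁻¹) M = M ∧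
        (M.map ((Matrix.toLin' (((u * G * u⁻¹ : GL (Fin 2) K) : Matrix (Fin 2) (Fin 2) K) -
            (((u * G * u⁻¹ : GL (Fin 2) K) : Matrix (Fin 2) (Fin 2) K).trace / 2) • (1 : Matrix (Fin 2) (Fin 2) K))).restrictScalars 𝒪[K]) ≤ scaleLattice c M ∧
          ¬ M.map ((Matrix.toLin' (((u * G * u⁻¹ : GL (Fin 2) K) : Matrix (Fin 2) (Fin 2) K) -
            (((u * G * u⁻¹ : GL (Fin 2) K) : Matrix (Fin 2) (Fin 2) K).trace / 2) • (1 : Matrix (Fin 2) (Fin 2) K))).restrictScalars 𝒪[K]) ≤ scaleLattice c' M ∧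
          ¬ ∃ y ∈ M, ∃ a : K, Valued.v a = 1 ∧ Valued.v (r * pairing σ H y ((((u * G * u⁻¹ : GL (Fin 2) K) : Matrix (Fin 2) (Fin 2) K) -
            (((u * G * u⁻¹ : GL (Fin 2) K) : Matrix (Fin 2) (Fin 2) K).trace / 2) • (1 : Matrix (Fin 2) (Fin 2) K)) *ᵥ y) - t * a ^ 2) < 1)}.ncard =
      {M : Submodule 𝒪[K] (Fin 2 → K) | IsSelfDualLattice σ ϖ H M ∧ mapGL G M = M ∧
        (M.map ((Matrix.toLin' ((G : Matrix (Fin 2) (Fin 2) K) - ((G : Matrix (Fin 2) (Fin 2) K).trace / 2) • (1 : Matrix (Fin 2) (Fin 2) K))).restrictScalars 𝒪[K]) ≤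
            scaleLattice c M ∧
          ¬ M.map ((Matrix.toLin' ((G : Matrix (Fin 2) (Fin 2) K) - ((G : Matrix (Fin 2) (Fin 2) K).trace / 2) • (1 : Matrix (Fin 2) (Fin 2) K))).restrictScalars 𝒪[K]) ≤
            scaleLattice c' M ∧
          ¬ ∃ y ∈ M, ∃ a : K, Valued.v a = 1 ∧ Valued.v (r * pairing σ H y (((G : Matrix (Fin 2) (Fin 2) K) - ((G : Matrix (Fin 2) (Fin 2) K).trace / 2) •
            (1 : Matrix (Fin 2) (Fin 2) K)) *ᵥ y) - t * a ^ 2) < 1)}.ncard := by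
  refine ncard_selfDual_fixed_sep_conj_eq_of_mem_unitaryGroupOfForm σ ϖ H hu G _ _ fun M => ?_
  rw [coe_conj_sub_half_trace_smul_one_eq, map_toLin'_conj_mapGL_le_scaleLattice_iff, map_toLin'_conj_mapGL_le_scaleLattice_iff]
  refine and_congr Iff.rfl (and_congr Iff.rfl (not_congr ?_))
  have h := exists_mem_mapGL_pairing_conj_iff σ H u ((G : Matrix (Fin 2) (Fin 2) K) - ((G : Matrix (Fin 2) (Fin 2) K).trace / 2) • (1 : Matrix (Fin 2) (Fin 2) K)) M
    (fun x => ∃ a : K, Valued.v a = 1 ∧ Valued.v (r * x - t * a ^ 2) < 1)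
  rw [formCongr_eq_of_mem_unitaryGroupOfForm σ H hu] at h
  exact h

end Generic

end Literature.NumberTheory.Automorphic.UnitaryLatticeTree


/-! ## §2 The inner kind count (CM dress) -/

namespace Literature.NumberTheory.Rogawski1990.BlockLawHyp

variable (L : Type) [Field L] [NumberField L] [IsCMField L] {v : HeightOneSpectrum (𝓞 ↥(maximalRealSubfield L))}
  (w : PlacesOver L v) (hw : IsCMField.complexConj L • w.1 = w.1)

set_option maxHeartbeats 1600000 in
-- budget only: statement-heavy CM lattice tokens.
/-- **THE INNER KIND COUNT OF THE HYPERBOLIC ROOT REGION, `N = 2n`, REGIME B** (`m = 2k′ + 3 < 2n`, `n = a + k′ + 1`): `n_inner = (q+1)·Σ_{i<a−1} q^i`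
(the centred `W`-ball of `ĝ_w` at scale `ϖ^(m+1) = ϖ^(2(k′+2))`; empty when `a = 1`).  FILE 1 ∘ ★ A-p12 `selfDual_fixed_lev_eq_ball_of_le` ∘ ★ A-p19
`ncard_selfDual_fixed_centredBall_inv_conj_scalar_mul_eq` ∘ ★ A-p12 `ncard_selfDual_fixed_ball[_top]_of_even_depth_ramified`.
[cite: Kottwitz1986, §3] [cite: Rogawski1990, §4.9 Lemma 4.9.3] [cite: LabesseLanglands1979, §2 Lemma 2.1 p. 8] [cite: BruhatTits1972, §10] -/
theorem ncard_rootRegion_inner_hyperbolic_of_even_B_ram (he : v.asIdeal.ramificationIdx' w.1.asIdeal ≠ 1)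
    (h2 : IsUnit (2 : (ValuativeRel.valuation (w.1.adicCompletion L)).integer))
    (ϖ : w.1.adicCompletion L) (hϖ : Valued.v ϖ = WithZero.exp (-1 : ℤ)) (hσϖ : galAdicCompletionMap (L := L) (IsCMField.complexConj L) hw ϖ = -ϖ)
    (γH : (cmDatum L 2 (Matrix.of fun i j : Fin 2 => if i.val + j.val + 1 = 2 then (1 : L) else 0)).Local v × (cmDatum L 1 (Matrix.of fun i j : Fin 1 => if i.val + j.val + 1 = 1 then (1 : L) else 0)).Local v)
    (hblk : ∀ i j : Fin 2, Valued.v (((((γH.1.val : GL (Fin 2) (UnitaryGroup.LocalRing L v)).val.map (Pi.evalRingHom (fun w' : PlacesOver L v => w'.1.adicCompletion L) w))) - 1) i j) ≤ Valued.v (ϖ ^ 2))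
    (hu2 : Valued.v (finGammaTwo L v γH w - 1) ≤ Valued.v (ϖ ^ 2))
    (hirr : ¬ ∃ x : (w.1.adicCompletion L), (((((γH.1.val : GL (Fin 2) (UnitaryGroup.LocalRing L v)).val.map (Pi.evalRingHom (fun w' : PlacesOver L v => w'.1.adicCompletion L) w)))).charpoly).IsRoot x)
    {n : ℕ}
    (hdisc : Valued.v (((((γH.1.val : GL (Fin 2) (UnitaryGroup.LocalRing L v)).val.map (Pi.evalRingHom (fun w' : PlacesOver L v => w'.1.adicCompletion L) w)))).trace ^ 2 - 4 * ((((γH.1.val : GL (Fin 2) (UnitaryGroup.LocalRing L v)).val.map (Pi.evalRingHom (fun w' : PlacesOver L v => w'.1.adicCompletion L) w)))).det) = WithZero.exp (-((2 * (2 * n) : ℕ) : ℤ)))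
    (m : ℕ) (hm : Valued.v (((finCharpolyTwo L v γH).eval (finGammaTwo L v γH)) w) =
      Valued.v ((toPlace v w (HeckeCharacter.uniformizer ↥(maximalRealSubfield L) v : v.adicCompletion ↥(maximalRealSubfield L))) ^ m))
    (β : (v.adicCompletion ↥(maximalRealSubfield L))ˣ)
    (hβ : toPlace v w (β : v.adicCompletion ↥(maximalRealSubfield L)) =
      -(((finCharpolyTwo L v γH).eval (finGammaTwo L v γH)) w *
          (finGammaTwo L v γH w ^ 2 + ((γH.1.val.val : Matrix (Fin 2) (Fin 2) (LocalRing L v)).map (Pi.evalRingHom (fun w' : PlacesOver L v => w'.1.adicCompletion L) w)).det)) /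
        (2 * finGammaTwo L v γH w ^ 2 * ((γH.1.val.val : Matrix (Fin 2) (Fin 2) (LocalRing L v)).map (Pi.evalRingHom (fun w' : PlacesOver L v => w'.1.adicCompletion L) w)).det))
    (s : (w.1.adicCompletion L)ˣ)
    (hs : (s : w.1.adicCompletion L) * (((localNonsplitEquiv (IsCMField.complexConj L) (Matrix.of fun i j : Fin 1 => if i.val + j.val + 1 = 1 then (1 : L) else 0) (IsCMField.complexConj_ne_one L) w hw γH.2).val : GL (Fin 1) (w.1.adicCompletion L)) : Matrix (Fin 1) (Fin 1) (w.1.adicCompletion L)) 0 0 = 1)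
    (k : GL (Fin 2) (w.1.adicCompletion L))
    (hk : k ∈ unitaryGroupOfForm (galAdicCompletionMap (L := L) (IsCMField.complexConj L) hw) (placeForm (Matrix.of fun i j : Fin 2 => if i.val + j.val + 1 = 2 then (1 : L) else 0) w.1))
    (γ : unitaryGroupOfForm (galAdicCompletionMap (L := L) (IsCMField.complexConj L) hw) ((StdForm.antidiagonal 3).over (w.1.adicCompletion L)))
    (hγ : (γ : GL (Fin 3) (w.1.adicCompletion L)) = endoGL ((k⁻¹ * (Matrix.GeneralLinearGroup.scalar (Fin 2) s * ((localNonsplitEquiv (IsCMField.complexConj L) (Matrix.of fun i j : Fin 2 => if i.val + j.val + 1 = 2 then (1 : L) else 0) (IsCMField.complexConj_ne_one L) w hw γH.1).val : GL (Fin 2) (w.1.adicCompletion L))) * k), (1 : GL (Fin 1) (w.1.adicCompletion L))))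
    (k' a : ℕ) (hmk : m = 2 * k' + 3) (hna : n = a + k' + 1) (hlt : m < 2 * n) :
    {x : {M : Submodule (Valued.integer (w.1.adicCompletion L)) (Fin 3 → (w.1.adicCompletion L)) // IsVertex (galAdicCompletionMap (L := L) (IsCMField.complexConj L) hw) ϖ ((StdForm.antidiagonal 3).over (w.1.adicCompletion L)) M} | x ∈ {x : {M : Submodule (Valued.integer (w.1.adicCompletion L)) (Fin 3 → (w.1.adicCompletion L)) // IsVertex (galAdicCompletionMap (L := L) (IsCMField.complexConj L) hw) ϖ ((StdForm.antidiagonal 3).over (w.1.adicCompletion L)) M} | latticeGraphIso (galAdicCompletionMap (L := L) (IsCMField.complexConj L) hw) ϖ ((StdForm.antidiagonal 3).over (w.1.adicCompletion L)) γ x = x ∧ IsSelfDualLattice (galAdicCompletionMap (L := L) (IsCMField.complexConj L) hw) ϖ ((StdForm.antidiagonal 3).over (w.1.adicCompletion L)) x.1 ∧ x.1.map ((Matrix.toLin' (((γ : GL (Fin 3) (w.1.adicCompletion L)) : Matrix (Fin 3) (Fin 3) (w.1.adicCompletion L)) - 1)).restrictScalars (Valued.integer (w.1.adicCompletion L)))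 ≤ scaleLattice (ϖ ^ m) x.1} ∧ (∀ y ∈ x.1, y 1 = 0 → ((((γ : GL (Fin 3) (w.1.adicCompletion L)) : Matrix (Fin 3) (Fin 3) (w.1.adicCompletion L)) - ((((k⁻¹ * (Matrix.GeneralLinearGroup.scalar (Fin 2) s * ((localNonsplitEquiv (IsCMField.complexConj L) (Matrix.of fun i j : Fin 2 => if i.val + j.val + 1 = 2 then (1 : L) else 0) (IsCMField.complexConj_ne_one L) w hw γH.1).val : GL (Fin 2) (w.1.adicCompletion L))) * k) : GL (Fin 2) (w.1.adicCompletion L)) : Matrix (Fin 2) (Fin 2) (w.1.adicCompletion L)).trace / 2) • (1 : Matrix (Fin 3) (Fin 3) (w.1.adicCompletion L))) *ᵥ y) ∈ scaleLattice (ϖ ^ (m + 1)) x.1)}.ncard =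
      (Nat.card (𝓞 ↥(maximalRealSubfield L) ⧸ v.asIdeal) + 1) * ∑ i ∈ Finset.range (a - 1), Nat.card (𝓞 ↥(maximalRealSubfield L) ⧸ v.asIdeal) ^ i := by
  haveI := isPrincipalIdealRing_integer_adicCompletion L v w
  have hϖ0 : ϖ ≠ 0 := fun h0 => by rw [h0, map_zero] at hϖ; exact WithZero.coe_ne_zero hϖ.symm
  have hϖlt : Valued.v ϖ < 1 := by rw [hϖ, ← WithZero.exp_zero]; exact WithZero.exp_lt_exp.2 (by norm_num)
  have hϖ1 : Valued.v ϖ ≤ 1 := hϖlt.le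
  have hvϖ0 : 0 < Valued.v ϖ := by rw [hϖ]; exact WithZero.exp_pos
  have h2w : Valued.v (2 : (w.1.adicCompletion L)) = 1 := (isUnit_two_integer_iff_valued_eq_one L w.1).1 h2
  have hσσ : ∀ z : (w.1.adicCompletion L), (galAdicCompletionMap (L := L) (IsCMField.complexConj L) hw) ((galAdicCompletionMap (L := L) (IsCMField.complexConj L) hw) z) = z :=
    galAdicCompletionMap_galAdicCompletionMap_of_smul_eq (IsCMField.complexConj L) w (IsCMField.complexConj_ne_one L) hw
  have hvσ : ∀ z : (w.1.adicCompletion L), Valued.v ((galAdicCompletionMap (L := L) (IsCMField.complexConj L) hw) z) = Valued.v z := fun z => valued_galAdicCompletionMap (L := L) (IsCMField.complexConj L) hw z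
  have hsv : Valued.v (s : (w.1.adicCompletion L)) = 1 := by
    have h := congrArg Valued.v hs
    rwa [map_mul, v_oneByOne_eq_one_of_local L w hw γH.2, mul_one, map_one] at h
  have hk' : k ∈ unitaryGroupOfForm (galAdicCompletionMap (L := L) (IsCMField.complexConj L) hw) (!![(0 : (w.1.adicCompletion L)), 1; 1, 0] : Matrix (Fin 2) (Fin 2) (w.1.adicCompletion L)) := by
    rw [← stdForm_antidiagonal_two_over_eq, ← placeForm_antidiagOne]; exact hk
  -- THM 1's value gap `|det(B₀ − 1)| = |ϖ|^(2m) > |ϖ|^(2m+1)` (★ A-p19 FILE 4)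
  have hdet : Valued.v ϖ ^ (2 * m + 1) < Valued.v ((((k⁻¹ * (Matrix.GeneralLinearGroup.scalar (Fin 2) s * ((localNonsplitEquiv (IsCMField.complexConj L) (Matrix.of fun i j : Fin 2 => if i.val + j.val + 1 = 2 then (1 : L) else 0) (IsCMField.complexConj_ne_one L) w hw γH.1).val : GL (Fin 2) (w.1.adicCompletion L))) * k) : GL (Fin 2) (w.1.adicCompletion L)) : Matrix (Fin 2) (Fin 2) (w.1.adicCompletion L)) - (1 : Matrix (Fin 2) (Fin 2) (w.1.adicCompletion L))).det := by
    rw [v_det_rerootedCentred_sub_one_eq_ram L w hw he ϖ hϖ γH m hm s hs k]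
    exact pow_lt_pow_right_of_lt_one₀ hvϖ0 hϖlt (by omega)
  -- the chair's dictionary, regime B: `|2û₀₀ − tr ĝ_w| = |ϖ^m|`
  obtain ⟨-, hB, -⟩ := typeTwo_depthDictionary_even_ram L w hw he h2 ϖ hϖ hσϖ hblk hu2 hirr hdisc m hm β hβ
  have hsc := (hB hlt).2.2.2
  -- FILE 1: the inner kind on the `W`-block of `B₀`
  rw [ncard_rootRegion_inner_eq_ncard_two hσσ hvσ hϖ γ _ hγ hdet]
  -- the plain level-`m` token of `B₀` is its centred one (A-p12 §3 at `Γ := B₀`; `|½tr B₀ − 1| = |ϖ^m|`)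
  have hck : Valued.v ((((k⁻¹ * (Matrix.GeneralLinearGroup.scalar (Fin 2) s * ((localNonsplitEquiv (IsCMField.complexConj L) (Matrix.of fun i j : Fin 2 => if i.val + j.val + 1 = 2 then (1 : L) else 0) (IsCMField.complexConj_ne_one L) w hw γH.1).val : GL (Fin 2) (w.1.adicCompletion L))) * k) : GL (Fin 2) (w.1.adicCompletion L)) : Matrix (Fin 2) (Fin 2) (w.1.adicCompletion L)).trace / 2 - 1) ≤ Valued.v (((Units.mk0 ϖ hϖ0 : (w.1.adicCompletion L)ˣ) : (w.1.adicCompletion L)) ^ m) := by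
    rw [trace_coe_inv_conj_scalar_mul, mul_div_assoc, v_mul_trace_div_two_sub_one_eq h2w hs hsv, Units.val_mk0, coe_localNonsplitEquiv_apply]
    exact hsc.le
  have e := selfDual_fixed_lev_eq_ball_of_le L v w hw he h2 (Units.mk0 ϖ hϖ0) (ϖ' := ϖ) _ m hck
  simp only [Units.val_mk0] at e
  -- drop the plain token: `LEV^c(ϖ^(m+1)) ⊆ LEV^c(ϖ^m) = LEV(ϖ^m)`
  have hdrop : {B : Submodule (Valued.integer (w.1.adicCompletion L)) (Fin 2 → (w.1.adicCompletion L)) | IsSelfDualLattice (galAdicCompletionMap (L := L) (IsCMField.complexConj L) hw) ϖ (!![(0 : (w.1.adicCompletion L)), 1; 1, 0] : Matrix (Fin 2) (Fin 2) (w.1.adicCompletion L)) B ∧ mapGL (k⁻¹ * (Matrix.GeneralLinearGroup.scalar (Fin 2) s * ((localNonsplitEquiv (IsCMField.complexConj L) (Matrix.of fun i j : Fin 2 => if i.val + j.val + 1 = 2 then (1 : L) else 0) (IsCMField.complexConj_ne_one L) w hw γH.1).val : GL (Fin 2) (w.1.adicCompletion L))) * k) B = B ∧ (B.map ((Matrix.toLin'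 ((((k⁻¹ * (Matrix.GeneralLinearGroup.scalar (Fin 2) s * ((localNonsplitEquiv (IsCMField.complexConj L) (Matrix.of fun i j : Fin 2 => if i.val + j.val + 1 = 2 then (1 : L) else 0) (IsCMField.complexConj_ne_one L) w hw γH.1).val : GL (Fin 2) (w.1.adicCompletion L))) * k) : GL (Fin 2) (w.1.adicCompletion L)) : Matrix (Fin 2) (Fin 2) (w.1.adicCompletion L)) - 1)).restrictScalars (Valued.integer (w.1.adicCompletion L))) ≤ scaleLattice (ϖ ^ m) B ∧ B.map ((Matrix.toLin' ((((k⁻¹ * (Matrix.GeneralLinearGroup.scalar (Fin 2) s * ((localNonsplitEquiv (IsCMField.complexConj L) (Matrix.of fun i j : Fin 2 => if i.val + j.val + 1 = 2 then (1 : L) else 0) (IsCMField.complexConj_ne_one L) w hw γH.1).val : GL (Fin 2) (w.1.adicCompletion L))) * k) : GL (Fin 2) (w.1.adicCompletion L)) : Matrix (Fin 2) (Fin 2) (w.1.adicCompletion L)) - ((((k⁻¹ * (Matrix.GeneralLinearGroup.scalar (Fin 2) s * ((localNonsplitEquiv (IsCMField.complexConj L) (Matrix.of fun i j : Fin 2 =>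 if i.val + j.val + 1 = 2 then (1 : L) else 0) (IsCMField.complexConj_ne_one L) w hw γH.1).val : GL (Fin 2) (w.1.adicCompletion L))) * k) : GL (Fin 2) (w.1.adicCompletion L)) : Matrix (Fin 2) (Fin 2) (w.1.adicCompletion L)).trace / 2) • (1 : Matrix (Fin 2) (Fin 2) (w.1.adicCompletion L)))).restrictScalars (Valued.integer (w.1.adicCompletion L))) ≤ scaleLattice (ϖ ^ (m + 1)) B)} =
      {B : Submodule (Valued.integer (w.1.adicCompletion L)) (Fin 2 → (w.1.adicCompletion L)) | IsSelfDualLattice (galAdicCompletionMap (L := L) (IsCMField.complexConj L) hw) ϖ (!![(0 : (w.1.adicCompletion L)), 1; 1, 0] : Matrix (Fin 2) (Fin 2) (w.1.adicCompletion L)) B ∧ mapGL (k⁻¹ * (Matrix.GeneralLinearGroup.scalar (Fin 2) s * ((localNonsplitEquiv (IsCMField.complexConj L) (Matrix.of fun i j : Fin 2 => if i.val + j.val + 1 = 2 then (1 : L) else 0) (IsCMField.complexConj_ne_one L) w hw γH.1).val : GL (Fin 2) (w.1.adicCompletion L))) * k) B = B ∧ (B.map ((Matrix.toLin' ((((k⁻¹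 * (Matrix.GeneralLinearGroup.scalar (Fin 2) s * ((localNonsplitEquiv (IsCMField.complexConj L) (Matrix.of fun i j : Fin 2 => if i.val + j.val + 1 = 2 then (1 : L) else 0) (IsCMField.complexConj_ne_one L) w hw γH.1).val : GL (Fin 2) (w.1.adicCompletion L))) * k) : GL (Fin 2) (w.1.adicCompletion L)) : Matrix (Fin 2) (Fin 2) (w.1.adicCompletion L)) - ((((k⁻¹ * (Matrix.GeneralLinearGroup.scalar (Fin 2) s * ((localNonsplitEquiv (IsCMField.complexConj L) (Matrix.of fun i j : Fin 2 => if i.val + j.val + 1 = 2 then (1 : L) else 0) (IsCMField.complexConj_ne_one L) w hw γH.1).val : GL (Fin 2) (w.1.adicCompletion L))) * k) : GL (Fin 2) (w.1.adicCompletion L)) : Matrix (Fin 2) (Fin 2) (w.1.adicCompletion L)).trace / 2) • (1 : Matrix (Fin 2) (Fin 2) (w.1.adicCompletion L)))).restrictScalars (Valued.integer (w.1.adicCompletion L))) ≤ scaleLattice (ϖ ^ (m + 1)) B)} := by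
    ext B
    simp only [Set.mem_setOf_eq]
    constructor
    · rintro ⟨hSD, hfix, -, hc⟩; exact ⟨hSD, hfix, hc⟩
    · rintro ⟨hSD, hfix, hc⟩
      exact ⟨hSD, hfix, ((Set.ext_iff.1 e B).2 ⟨hSD, hfix, hc.trans (scaleLattice_pow_succ_le hϖ1 B m)⟩).2.2, hc⟩
  rw [hdrop, ncard_selfDual_fixed_centredBall_inv_conj_scalar_mul_eq _ hk' _ hsv (pow_ne_zero (m + 1) hϖ0)]
  -- A-p12's even-depth centred ball of `ĝ_w` at `j = k′ + 2` (the empty top ball when `a = 1`)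
  rcases Nat.lt_or_ge 1 a with ha | ha
  · have c := ncard_selfDual_fixed_ball_of_even_depth_ramified L v w hw he h2 (Units.mk0 ϖ hϖ0) hϖ hσϖ γH.1 hirr hblk hdisc (j := k' + 2) (by omega)
    simp only [Units.val_mk0] at c
    rw [show m + 1 = 2 * (k' + 2) by omega, c, show n - (k' + 2) = a - 1 by omega]
  · have ha1 : a = 1 := by omega
    have c := ncard_selfDual_fixed_ball_top_of_even_depth_ramified L v w hw he h2 (Units.mk0 ϖ hϖ0) hϖ hσϖ γH.1 hirr hblk (n := n) (by omega) hdisc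
    simp only [Units.val_mk0] at c
    rw [show m + 1 = 2 * n by omega, c, ha1]
    simp

set_option maxHeartbeats 1600000 in
-- budget only: statement-heavy CM lattice tokens.
/-- **THE INNER KIND COUNT OF THE HYPERBOLIC ROOT REGION, `N = 2n+1`, REGIME B** (`m = 2k′ + 3 < 2n+1`, `n = a + k′ + 1`): `n_inner + 1 = 2·Σ_{i<a} q^i`
(the centred `W`-ball of `ĝ_w` at scale `ϖ^(m+1) = ϖ^(2(k′+2))`).  FILE 1 ∘ ★ A-p12 `selfDual_fixed_lev_eq_ball_of_le` ∘ ★ A-p19 `ncard_selfDual_fixed_centredBall_inv_conj_scalar_mul_eq`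
∘ ★ A-p12 `ncard_selfDual_fixed_ball_of_odd_depth_ramified`. [cite: Kottwitz1986, §3] [cite: Rogawski1990, §4.9 Lemma 4.9.3] [cite: LabesseLanglands1979, §2 Lemma 2.1 p. 8] [cite: BruhatTits1972, §10] -/
theorem ncard_rootRegion_inner_hyperbolic_of_odd_B_ram (he : v.asIdeal.ramificationIdx' w.1.asIdeal ≠ 1)
    (h2 : IsUnit (2 : (ValuativeRel.valuation (w.1.adicCompletion L)).integer))
    (ϖ : w.1.adicCompletion L) (hϖ : Valued.v ϖ = WithZero.exp (-1 : ℤ)) (hσϖ : galAdicCompletionMap (L := L) (IsCMField.complexConj L) hw ϖ = -ϖ)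
    (γH : (cmDatum L 2 (Matrix.of fun i j : Fin 2 => if i.val + j.val + 1 = 2 then (1 : L) else 0)).Local v × (cmDatum L 1 (Matrix.of fun i j : Fin 1 => if i.val + j.val + 1 = 1 then (1 : L) else 0)).Local v)
    (hblk : ∀ i j : Fin 2, Valued.v (((((γH.1.val : GL (Fin 2) (UnitaryGroup.LocalRing L v)).val.map (Pi.evalRingHom (fun w' : PlacesOver L v => w'.1.adicCompletion L) w))) - 1) i j) ≤ Valued.v (ϖ ^ 2))
    (hu2 : Valued.v (finGammaTwo L v γH w - 1) ≤ Valued.v (ϖ ^ 2))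
    (hirr : ¬ ∃ x : (w.1.adicCompletion L), (((((γH.1.val : GL (Fin 2) (UnitaryGroup.LocalRing L v)).val.map (Pi.evalRingHom (fun w' : PlacesOver L v => w'.1.adicCompletion L) w)))).charpoly).IsRoot x)
    {n : ℕ}
    (hdisc : Valued.v (((((γH.1.val : GL (Fin 2) (UnitaryGroup.LocalRing L v)).val.map (Pi.evalRingHom (fun w' : PlacesOver L v => w'.1.adicCompletion L) w)))).trace ^ 2 - 4 * ((((γH.1.val : GL (Fin 2) (UnitaryGroup.LocalRing L v)).val.map (Pi.evalRingHom (fun w' : PlacesOver L v => w'.1.adicCompletion L) w)))).det) = WithZero.exp (-((2 * (2 * n + 1) : ℕ) : ℤ)))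
    (m : ℕ) (hm : Valued.v (((finCharpolyTwo L v γH).eval (finGammaTwo L v γH)) w) =
      Valued.v ((toPlace v w (HeckeCharacter.uniformizer ↥(maximalRealSubfield L) v : v.adicCompletion ↥(maximalRealSubfield L))) ^ m))
    (β : (v.adicCompletion ↥(maximalRealSubfield L))ˣ)
    (hβ : toPlace v w (β : v.adicCompletion ↥(maximalRealSubfield L)) =
      -(((finCharpolyTwo L v γH).eval (finGammaTwo L v γH)) w *
          (finGammaTwo L v γH w ^ 2 + ((γH.1.val.val : Matrix (Fin 2) (Fin 2) (LocalRing L v)).map (Pi.evalRingHom (fun w' : PlacesOver L v => w'.1.adicCompletion L) w)).det)) /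
        (2 * finGammaTwo L v γH w ^ 2 * ((γH.1.val.val : Matrix (Fin 2) (Fin 2) (LocalRing L v)).map (Pi.evalRingHom (fun w' : PlacesOver L v => w'.1.adicCompletion L) w)).det))
    (s : (w.1.adicCompletion L)ˣ)
    (hs : (s : w.1.adicCompletion L) * (((localNonsplitEquiv (IsCMField.complexConj L) (Matrix.of fun i j : Fin 1 => if i.val + j.val + 1 = 1 then (1 : L) else 0) (IsCMField.complexConj_ne_one L) w hw γH.2).val : GL (Fin 1) (w.1.adicCompletion L)) : Matrix (Fin 1) (Fin 1) (w.1.adicCompletion L)) 0 0 = 1)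
    (k : GL (Fin 2) (w.1.adicCompletion L))
    (hk : k ∈ unitaryGroupOfForm (galAdicCompletionMap (L := L) (IsCMField.complexConj L) hw) (placeForm (Matrix.of fun i j : Fin 2 => if i.val + j.val + 1 = 2 then (1 : L) else 0) w.1))
    (γ : unitaryGroupOfForm (galAdicCompletionMap (L := L) (IsCMField.complexConj L) hw) ((StdForm.antidiagonal 3).over (w.1.adicCompletion L)))
    (hγ : (γ : GL (Fin 3) (w.1.adicCompletion L)) = endoGL ((k⁻¹ * (Matrix.GeneralLinearGroup.scalar (Fin 2) s * ((localNonsplitEquiv (IsCMField.complexConj L) (Matrix.of fun i j : Fin 2 => if i.val + j.val + 1 = 2 then (1 : L) else 0) (IsCMField.complexConj_ne_one L) w hw γH.1).val : GL (Fin 2) (w.1.adicCompletion L))) * k), (1 : GL (Fin 1) (w.1.adicCompletion L))))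
    (k' a : ℕ) (hmk : m = 2 * k' + 3) (hna : n = a + k' + 1) (hlt : m < 2 * n + 1) :
    {x : {M : Submodule (Valued.integer (w.1.adicCompletion L)) (Fin 3 → (w.1.adicCompletion L)) // IsVertex (galAdicCompletionMap (L := L) (IsCMField.complexConj L) hw) ϖ ((StdForm.antidiagonal 3).over (w.1.adicCompletion L)) M} | x ∈ {x : {M : Submodule (Valued.integer (w.1.adicCompletion L)) (Fin 3 → (w.1.adicCompletion L)) // IsVertex (galAdicCompletionMap (L := L) (IsCMField.complexConj L) hw) ϖ ((StdForm.antidiagonal 3).over (w.1.adicCompletion L)) M} | latticeGraphIso (galAdicCompletionMap (L := L) (IsCMField.complexConj L) hw) ϖ ((StdForm.antidiagonal 3).over (w.1.adicCompletion L)) γ x = x ∧ IsSelfDualLattice (galAdicCompletionMap (L := L) (IsCMField.complexConj L) hw) ϖ ((StdForm.antidiagonal 3).over (w.1.adicCompletion L)) x.1 ∧ x.1.map ((Matrix.toLin' (((γ : GL (Fin 3) (w.1.adicCompletion L)) : Matrix (Fin 3) (Fin 3) (w.1.adicCompletion L)) - 1)).restrictScalars (Valued.integer (w.1.adicCompletion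 L))) ≤ scaleLattice (ϖ ^ m) x.1} ∧ (∀ y ∈ x.1, y 1 = 0 → ((((γ : GL (Fin 3) (w.1.adicCompletion L)) : Matrix (Fin 3) (Fin 3) (w.1.adicCompletion L)) - ((((k⁻¹ * (Matrix.GeneralLinearGroup.scalar (Fin 2) s * ((localNonsplitEquiv (IsCMField.complexConj L) (Matrix.of fun i j : Fin 2 => if i.val + j.val + 1 = 2 then (1 : L) else 0) (IsCMField.complexConj_ne_one L) w hw γH.1).val : GL (Fin 2) (w.1.adicCompletion L))) * k) : GL (Fin 2) (w.1.adicCompletion L)) : Matrix (Fin 2) (Fin 2) (w.1.adicCompletion L)).trace / 2) • (1 : Matrix (Fin 3) (Fin 3) (w.1.adicCompletion L))) *ᵥ y) ∈ scaleLattice (ϖ ^ (m + 1)) x.1)}.ncard + 1 =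
      2 * ∑ i ∈ Finset.range a, Nat.card (𝓞 ↥(maximalRealSubfield L) ⧸ v.asIdeal) ^ i := by
  haveI := isPrincipalIdealRing_integer_adicCompletion L v w
  have hϖ0 : ϖ ≠ 0 := fun h0 => by rw [h0, map_zero] at hϖ; exact WithZero.coe_ne_zero hϖ.symm
  have hϖlt : Valued.v ϖ < 1 := by rw [hϖ, ← WithZero.exp_zero]; exact WithZero.exp_lt_exp.2 (by norm_num)
  have hϖ1 : Valued.v ϖ ≤ 1 := hϖlt.le
  have hvϖ0 : 0 < Valued.v ϖ := by rw [hϖ]; exact WithZero.exp_pos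
  have h2w : Valued.v (2 : (w.1.adicCompletion L)) = 1 := (isUnit_two_integer_iff_valued_eq_one L w.1).1 h2
  have hσσ : ∀ z : (w.1.adicCompletion L), (galAdicCompletionMap (L := L) (IsCMField.complexConj L) hw) ((galAdicCompletionMap (L := L) (IsCMField.complexConj L) hw) z) = z :=
    galAdicCompletionMap_galAdicCompletionMap_of_smul_eq (IsCMField.complexConj L) w (IsCMField.complexConj_ne_one L) hw
  have hvσ : ∀ z : (w.1.adicCompletion L), Valued.v ((galAdicCompletionMap (L := L) (IsCMField.complexConj L) hw) z) = Valued.v z := fun z => valued_galAdicCompletionMap (L := L) (IsCMField.complexConj L) hw z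
  have hsv : Valued.v (s : (w.1.adicCompletion L)) = 1 := by
    have h := congrArg Valued.v hs
    rwa [map_mul, v_oneByOne_eq_one_of_local L w hw γH.2, mul_one, map_one] at h
  have hk' : k ∈ unitaryGroupOfForm (galAdicCompletionMap (L := L) (IsCMField.complexConj L) hw) (!![(0 : (w.1.adicCompletion L)), 1; 1, 0] : Matrix (Fin 2) (Fin 2) (w.1.adicCompletion L)) := by
    rw [← stdForm_antidiagonal_two_over_eq, ← placeForm_antidiagOne]; exact hk
  -- THM 1's value gap `|det(B₀ − 1)| = |ϖ|^(2m) > |ϖ|^(2m+1)` (★ A-p19 FILE 4)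
  have hdet : Valued.v ϖ ^ (2 * m + 1) < Valued.v ((((k⁻¹ * (Matrix.GeneralLinearGroup.scalar (Fin 2) s * ((localNonsplitEquiv (IsCMField.complexConj L) (Matrix.of fun i j : Fin 2 => if i.val + j.val + 1 = 2 then (1 : L) else 0) (IsCMField.complexConj_ne_one L) w hw γH.1).val : GL (Fin 2) (w.1.adicCompletion L))) * k) : GL (Fin 2) (w.1.adicCompletion L)) : Matrix (Fin 2) (Fin 2) (w.1.adicCompletion L)) - (1 : Matrix (Fin 2) (Fin 2) (w.1.adicCompletion L))).det := by
    rw [v_det_rerootedCentred_sub_one_eq_ram L w hw he ϖ hϖ γH m hm s hs k]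
    exact pow_lt_pow_right_of_lt_one₀ hvϖ0 hϖlt (by omega)
  -- the chair's dictionary, regime B: `|2û₀₀ − tr ĝ_w| = |ϖ^m|`
  obtain ⟨-, hB, -⟩ := typeTwo_depthDictionary_odd_ram L w hw he h2 ϖ hϖ hσϖ hblk hu2 hirr hdisc m hm β hβ
  have hsc := (hB hlt).2.2.2
  -- FILE 1: the inner kind on the `W`-block of `B₀`
  rw [ncard_rootRegion_inner_eq_ncard_two hσσ hvσ hϖ γ _ hγ hdet]
  -- the plain level-`m` token of `B₀` is its centred one (A-p12 §3 at `Γ := B₀`; `|½tr B₀ − 1| = |ϖ^m|`)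
  have hck : Valued.v ((((k⁻¹ * (Matrix.GeneralLinearGroup.scalar (Fin 2) s * ((localNonsplitEquiv (IsCMField.complexConj L) (Matrix.of fun i j : Fin 2 => if i.val + j.val + 1 = 2 then (1 : L) else 0) (IsCMField.complexConj_ne_one L) w hw γH.1).val : GL (Fin 2) (w.1.adicCompletion L))) * k) : GL (Fin 2) (w.1.adicCompletion L)) : Matrix (Fin 2) (Fin 2) (w.1.adicCompletion L)).trace / 2 - 1) ≤ Valued.v (((Units.mk0 ϖ hϖ0 : (w.1.adicCompletion L)ˣ) : (w.1.adicCompletion L)) ^ m) := by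
    rw [trace_coe_inv_conj_scalar_mul, mul_div_assoc, v_mul_trace_div_two_sub_one_eq h2w hs hsv, Units.val_mk0, coe_localNonsplitEquiv_apply]
    exact hsc.le
  have e := selfDual_fixed_lev_eq_ball_of_le L v w hw he h2 (Units.mk0 ϖ hϖ0) (ϖ' := ϖ) _ m hck
  simp only [Units.val_mk0] at e
  -- drop the plain token: `LEV^c(ϖ^(m+1)) ⊆ LEV^c(ϖ^m) = LEV(ϖ^m)`
  have hdrop : {B : Submodule (Valued.integer (w.1.adicCompletion L)) (Fin 2 → (w.1.adicCompletion L)) | IsSelfDualLattice (galAdicCompletionMap (L := L) (IsCMField.complexConj L) hw) ϖ (!![(0 : (w.1.adicCompletion L)), 1; 1, 0] : Matrix (Fin 2) (Fin 2) (w.1.adicCompletion L)) B ∧ mapGL (k⁻¹ * (Matrix.GeneralLinearGroup.scalar (Fin 2) s * ((localNonsplitEquiv (IsCMField.complexConj L) (Matrix.of fun i j : Fin 2 => if i.val + j.val + 1 = 2 then (1 : L) else 0) (IsCMField.complexConj_ne_one L) w hw γH.1).val : GL (Fin 2) (w.1.adicCompletion L))) * k) B = B ∧ (B.map ((Matrix.toLin'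 ((((k⁻¹ * (Matrix.GeneralLinearGroup.scalar (Fin 2) s * ((localNonsplitEquiv (IsCMField.complexConj L) (Matrix.of fun i j : Fin 2 => if i.val + j.val + 1 = 2 then (1 : L) else 0) (IsCMField.complexConj_ne_one L) w hw γH.1).val : GL (Fin 2) (w.1.adicCompletion L))) * k) : GL (Fin 2) (w.1.adicCompletion L)) : Matrix (Fin 2) (Fin 2) (w.1.adicCompletion L)) - 1)).restrictScalars (Valued.integer (w.1.adicCompletion L))) ≤ scaleLattice (ϖ ^ m) B ∧ B.map ((Matrix.toLin' ((((k⁻¹ * (Matrix.GeneralLinearGroup.scalar (Fin 2) s * ((localNonsplitEquiv (IsCMField.complexConj L) (Matrix.of fun i j : Fin 2 => if i.val + j.val + 1 = 2 then (1 : L) else 0) (IsCMField.complexConj_ne_one L) w hw γH.1).val : GL (Fin 2) (w.1.adicCompletion L))) * k) : GL (Fin 2) (w.1.adicCompletion L)) : Matrix (Fin 2) (Fin 2) (w.1.adicCompletion L)) - ((((k⁻¹ * (Matrix.GeneralLinearGroup.scalar (Fin 2) s * ((localNonsplitEquiv (IsCMField.complexConj L) (Matrix.of fun i j : Fin 2 =>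 if i.val + j.val + 1 = 2 then (1 : L) else 0) (IsCMField.complexConj_ne_one L) w hw γH.1).val : GL (Fin 2) (w.1.adicCompletion L))) * k) : GL (Fin 2) (w.1.adicCompletion L)) : Matrix (Fin 2) (Fin 2) (w.1.adicCompletion L)).trace / 2) • (1 : Matrix (Fin 2) (Fin 2) (w.1.adicCompletion L)))).restrictScalars (Valued.integer (w.1.adicCompletion L))) ≤ scaleLattice (ϖ ^ (m + 1)) B)} =
      {B : Submodule (Valued.integer (w.1.adicCompletion L)) (Fin 2 → (w.1.adicCompletion L)) | IsSelfDualLattice (galAdicCompletionMap (L := L) (IsCMField.complexConj L) hw) ϖ (!![(0 : (w.1.adicCompletion L)), 1; 1, 0] : Matrix (Fin 2) (Fin 2) (w.1.adicCompletion L)) B ∧ mapGL (k⁻¹ * (Matrix.GeneralLinearGroup.scalar (Fin 2) s * ((localNonsplitEquiv (IsCMField.complexConj L) (Matrix.of fun i j : Fin 2 => if i.val + j.val + 1 = 2 then (1 : L) else 0) (IsCMField.complexConj_ne_one L) w hw γH.1).val : GL (Fin 2) (w.1.adicCompletion L))) * k) B = B ∧ (B.map ((Matrix.toLin' ((((k⁻¹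 * (Matrix.GeneralLinearGroup.scalar (Fin 2) s * ((localNonsplitEquiv (IsCMField.complexConj L) (Matrix.of fun i j : Fin 2 => if i.val + j.val + 1 = 2 then (1 : L) else 0) (IsCMField.complexConj_ne_one L) w hw γH.1).val : GL (Fin 2) (w.1.adicCompletion L))) * k) : GL (Fin 2) (w.1.adicCompletion L)) : Matrix (Fin 2) (Fin 2) (w.1.adicCompletion L)) - ((((k⁻¹ * (Matrix.GeneralLinearGroup.scalar (Fin 2) s * ((localNonsplitEquiv (IsCMField.complexConj L) (Matrix.of fun i j : Fin 2 => if i.val + j.val + 1 = 2 then (1 : L) else 0) (IsCMField.complexConj_ne_one L) w hw γH.1).val : GL (Fin 2) (w.1.adicCompletion L))) * k) : GL (Fin 2) (w.1.adicCompletion L)) : Matrix (Fin 2) (Fin 2) (w.1.adicCompletion L)).trace / 2) • (1 : Matrix (Fin 2) (Fin 2) (w.1.adicCompletion L)))).restrictScalars (Valued.integer (w.1.adicCompletion L))) ≤ scaleLattice (ϖ ^ (m + 1)) B)} := by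
    ext B
    simp only [Set.mem_setOf_eq]
    constructor
    · rintro ⟨hSD, hfix, -, hc⟩; exact ⟨hSD, hfix, hc⟩
    · rintro ⟨hSD, hfix, hc⟩
      exact ⟨hSD, hfix, ((Set.ext_iff.1 e B).2 ⟨hSD, hfix, hc.trans (scaleLattice_pow_succ_le hϖ1 B m)⟩).2.2, hc⟩
  rw [hdrop, ncard_selfDual_fixed_centredBall_inv_conj_scalar_mul_eq _ hk' _ hsv (pow_ne_zero (m + 1) hϖ0)]
  -- A-p12's odd-depth centred ball of `ĝ_w` at `j = k′ + 2`
  have c := ncard_selfDual_fixed_ball_of_odd_depth_ramified L v w hw he h2 (Units.mk0 ϖ hϖ0) hϖ hσϖ γH.1 hirr hblk hdisc (j := k' + 2) (by omega)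
  simp only [Units.val_mk0] at c
  rw [show m + 1 = 2 * (k' + 2) by omega, c, show n - (k' + 2) + 1 = a by omega]

end Literature.NumberTheory.Rogawski1990.BlockLawHyp

end
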